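import Summits.RiemannHypothesis.RiemannHypothesis.Theorems.SoloInformedWeilSurface
import Literature.NumberTheory.ConnesConsani2019.RiemannRochStrategy

/-!
# Motivic door (cell `pub-rhdoor`, seat cc-3): the would-be Castelnuovo–Severi inequality for
Connes–Consani's simplest divisors `D(f)` is Weil positivity, test function by test function

HONEST FRAMING (cell charter, verbatim): lottery ticket at the motivic door; RH probability
negligible; consolation prizes are real.  This file is bookkeeping, not progress on RH.  It makes a
one-line DERIVED identity of the cell's report (`HODGE-INDEX.md` §2 (CS-Q), `LOCATED-GAP.md` §cc-3,
paper §3.3 "the would-be Castelnuovo–Severi inequality IS Weil's criterion") a kernel statement over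
the objects of A. Connes, C. Consani, *The Riemann–Roch strategy* (arXiv:1805.10501) §3.1 as typed in
`Literature/NumberTheory/ConnesConsani2019/RiemannRochStrategy.lean` (`ccPairing` = `𝔰`,
`massDstar f = ∫ f d^*u`, `massDu f = ∫ f du`, `toMul`).

The classical step (Weil 1948; Mattuck–Tate, Grothendieck 1958; Hartshorne V Ex. 1.9–1.10): on
`C × C'` a divisor `D` with degrees `d₁ = D·(pt × C')`, `d₂ = D·(C × pt)` over the two rulings
satisfies `D² ≤ 2 d₁ d₂` (Castelnuovo–Severi), equivalently the Hodge index inequality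
`(D − d₂ ξ₁ − d₁ ξ₂)² ≤ 0` on the class orthogonal to the hyperbolic plane of the rulings.
Connes's *Essay* (arXiv:1509.05576) §2.1 Lemma 2.1 isolates exactly this bilinear-algebra step, and
§4.1 (p. 20) proposes the divisors `D(f) = ∫ f(λ) Ψ_λ d^*λ` on the square of the arithmetic /
scaling site with the DECREED self-intersection `½ D(f).D(f) = s(f,f)` (Essay) — resp.
`D • D = 𝔰(f,f)` (2019, eq. (17)) — and bidegree `(∫ f d^*u, ∫ f du)` (2019 p. 10).

PROVED here (elementary, from the tree's normalisation theorem `two_mul_ccPairing_toMul_eq`: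
`2 𝔰(f,f) = weilPoleForm g − Re Q(g)`, and Yoshida's polar identity
`two_mul_re_weilMellin_zero_mul_conj_one`), for `f = toMul u`, `g = u` a real test function:

* `weilPoleForm_ofReal_eq_two_mul_massDstar_mul_massDu`: `P(g) = 2 (∫ f d^*u)(∫ f du)` — the polar
  term of the explicit formula IS the hyperbolic plane of the two rulings evaluated on the bidegree;
* `two_mul_ccPairing_toMul_eq_masses_sub`: `(D.D)_Essay = 2 𝔰(f,f) = 2 d₀ d₁ − Re Q(g)` — the row
  `inter_corr_self` of the abstract `WeilSurface` (`SoloInformedWeilSurface.lean`) on CC's own objects;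
* `two_mul_ccPairing_sub_two_mul_masses_eq`: the "primitive projection" has self-intersection
  `−Re Q(g)`;
* `ccPairing_le_masses_iff`: Castelnuovo–Severi for `D(f)`, `2 𝔰(f,f) ≤ 2 d₀ d₁`, holds iff
  `0 ≤ Re Q(g)` — Weil positivity AT THE SAME TEST FUNCTION;
* `forall_ccPairing_le_masses_iff_weilPositivity`, `…_iff_riemannHypothesis`: Castelnuovo–Severi for
  every real `D(f)` ⟺ `WeilPositivity` ⟺ RH (Weil's criterion `weil_criterion_holds`, Bombieri 2000
  Thm. 2, in the tree);
* `criterion_of_forall_ccPairing_le_masses`: Castelnuovo–Severi ⟹ CC's criterion (15) (Hodge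
  negativity on the classes `D(f)` that are already of bidegree `(0,0)`) is FORMAL (`d₀ = d₁ = 0`);
  the converse `forall_ccPairing_le_masses_of_criterion` is stated under the named fact
  `(h : eq15)` — it is NOT formal: in the tree it is the zero-detection theorem
  `riemannHypothesis_iff_poleFree` (which discharges `eq15`, `MotivicDoorCC2019Criterion.lean`).

What this certifies for the cell's classification (a)/(b)/(c): outcome (a) — the inequality the
Riemann–Roch strategy must OUTPUT for the simplest divisors is statable and is literally the windowed
/ full Weil form the data seats already serve; no new numerical test arises.  The content of the
strategy is in the INPUTS (an `H⁰`, a Riemann–Roch lower bound and a vanishing upper bound on a square,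
with `D • D` forced rather than decreed) — none constructed in print (`LOCATED-GAP.md` §cc-3, G1–G7).
No `def : Prop` is introduced here (the inequality is written out in each statement); no RH claim.

References: Connes–Consani 2019 §3.1 eqs. (15)–(17) [ConnesConsani2019RiemannRochStrategy]; Connes
2016 §2.1 Lemma 2.1, §4.1 [Connes2016EssayRH]; E. Bombieri 2000, Thm. 2 [Bombieri2000Weil];
R. Hartshorne, *Algebraic Geometry*, V Thm. 1.9, Ex. 1.9–1.10; B. Kahn, *Zeta and L-functions of
varieties and motives* (CUP 2020) §2.9 Thm. 2.37–2.40.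
-/

-- lint debt (one line): the D-0017 layout forces the doubled path component `RiemannHypothesis.RiemannHypothesis`.
set_option linter.dupNamespace false

namespace Summit.RiemannHypothesis.RiemannHypothesis.Theorems.MotivicDoor.ConnesConsani

open Complex Set MeasureTheory
open scoped ComplexConjugate
open Literature.NumberTheory.LFunctions Literature.NumberTheory.ConnesConsani2019

/-! ## The hyperbolic plane of the rulings is the polar term -/

/-- **`P(g) = 2 d₀ d₁`.**  For a real test function `u` (`g = u`, `f = toMul u`), the pole form
`weilPoleForm g = 2 Re(ĝ(0) conj ĝ(1))` equals `2 (∫ f d^*u)(∫ f du)`: the polar term of the explicit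
formula is the intersection form of the hyperbolic plane `⟨ξ₀, ξ₁⟩` (`ξ_j² = 0`, `ξ₀·ξ₁ = 1`)
evaluated on CC's bidegree `(d₀, d₁) = (∫ f d^*u, ∫ f du)` of `D(f)` (arXiv:1805.10501 p. 10). -/
theorem weilPoleForm_ofReal_eq_two_mul_massDstar_mul_massDu {u : ℝ → ℝ}
    (hu : IsWeilTest (fun t ↦ (u t : ℂ))) :
    weilPoleForm (fun t ↦ (u t : ℂ)) = 2 * (massDstar (toMul u) * massDu (toMul u)) := by
  rw [← two_mul_re_weilMellin_zero_mul_conj_one hu, weilMellin_zero_eq_massDstar,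
    weilMellin_one_eq_massDu, Complex.conj_ofReal, ← Complex.ofReal_mul, Complex.ofReal_re]

/-- **`(D.D)_Essay = 2 𝔰(f,f) = 2 d₀ d₁ − Re Q(g)`** (real `u`, `g = u`, `f = toMul u`): the decreed
self-intersection of `D(f)` in the Essay normalisation (`½ D.D = s(f,f)`, arXiv:1509.05576 p. 20) is the
hyperbolic part minus Weil's quadratic functional — the `inter_corr_self` axiom of the abstract
`WeilSurface` (`corr g · corr g = 2 Re ĝ(0) Re ĝ(1) − Re Q(g)`) read on CC's own objects. -/
theorem two_mul_ccPairing_toMul_eq_masses_sub {u : ℝ → ℝ}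
    (hu : IsWeilTest (fun t ↦ (u t : ℂ))) :
    2 * ccPairing (toMul u) (toMul u) =
      2 * (massDstar (toMul u) * massDu (toMul u)) - (weilQuadratic fun t ↦ (u t : ℂ)).re := by
  rw [two_mul_ccPairing_toMul_eq hu, weilPoleForm_ofReal_eq_two_mul_massDstar_mul_massDu hu]

/-- **Primitive projection.**  `2 𝔰(f,f) − 2 d₀ d₁ = −Re Q(g)`: classically `(D − d₂ξ₁ − d₁ξ₂)² =
D² − 2 d₁ d₂`, the self-intersection of the component of `D` orthogonal to the rulings; for CC's
`D(f)` that component squares to minus Weil's functional. -/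
theorem two_mul_ccPairing_sub_two_mul_masses_eq {u : ℝ → ℝ}
    (hu : IsWeilTest (fun t ↦ (u t : ℂ))) :
    2 * ccPairing (toMul u) (toMul u) - 2 * (massDstar (toMul u) * massDu (toMul u)) =
      -(weilQuadratic fun t ↦ (u t : ℂ)).re := by
  rw [two_mul_ccPairing_toMul_eq_masses_sub hu]; ring

/-! ## Castelnuovo–Severi for `D(f)` is Weil positivity at the same test function -/

/-- **Castelnuovo–Severi for one divisor `D(f)` ⟺ `Re Q(g) ≥ 0`** (real `u`, `g = u`, `f = toMul u`):
`D.D ≤ 2 d₀ d₁`, i.e. `2 𝔰(f,f) ≤ 2 (∫ f d^*u)(∫ f du)`, holds iff Weil's quadratic functional is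
non-negative at the same `g`.  (The cell's (CS-Q), previously DERIVED.) -/
theorem ccPairing_le_masses_iff {u : ℝ → ℝ} (hu : IsWeilTest (fun t ↦ (u t : ℂ))) :
    2 * ccPairing (toMul u) (toMul u) ≤ 2 * (massDstar (toMul u) * massDu (toMul u)) ↔
      0 ≤ (weilQuadratic fun t ↦ (u t : ℂ)).re := by
  rw [two_mul_ccPairing_toMul_eq_masses_sub hu]
  constructor <;> intro h <;> linarith

/-- **Castelnuovo–Severi for every real `D(f)` ⟺ Weil positivity** (complex tests reduce to real
ones, `weilPositivity_iff_real`). -/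
theorem forall_ccPairing_le_masses_iff_weilPositivity :
    (∀ u : ℝ → ℝ, IsWeilTest (fun t ↦ (u t : ℂ)) →
        2 * ccPairing (toMul u) (toMul u) ≤ 2 * (massDstar (toMul u) * massDu (toMul u))) ↔
      WeilPositivity := by
  rw [weilPositivity_iff_real]
  exact forall₂_congr fun u hu ↦ ccPairing_le_masses_iff hu

/-- **Castelnuovo–Severi for every real `D(f)` ⟺ RH** (Weil's criterion, `weil_criterion_holds`,
Bombieri 2000 Thm. 2 — in the tree; nothing new about RH). -/
theorem forall_ccPairing_le_masses_iff_riemannHypothesis :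
    (∀ u : ℝ → ℝ, IsWeilTest (fun t ↦ (u t : ℂ)) →
        2 * ccPairing (toMul u) (toMul u) ≤ 2 * (massDstar (toMul u) * massDu (toMul u))) ↔
      _root_.RiemannHypothesis :=
  forall_ccPairing_le_masses_iff_weilPositivity.trans
    (show _root_.RiemannHypothesis ↔ WeilPositivity from weil_criterion_holds).symm

/-! ## Castelnuovo–Severi versus CC's criterion (15) (Hodge negativity on bidegree-(0,0) classes) -/

/-- **Formal direction.**  Castelnuovo–Severi for every real `D(f)` implies CC 2019 eq. (15)'s
right-hand side `Criterion` (`∫ f d^*u = ∫ f du = 0 ⟹ 𝔰(f,f) ≤ 0`): put `d₀ = d₁ = 0`. -/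
theorem criterion_of_forall_ccPairing_le_masses
    (h : ∀ u : ℝ → ℝ, IsWeilTest (fun t ↦ (u t : ℂ)) →
      2 * ccPairing (toMul u) (toMul u) ≤ 2 * (massDstar (toMul u) * massDu (toMul u))) :
    Criterion := by
  intro u hu h0 h1
  have h2 := h u hu
  rw [h0, h1, mul_zero, mul_zero] at h2
  linarith

/-- **Non-formal direction, under the named fact `eq15`.**  CC's criterion (15) (negativity only on
the classes `D(f)` that are ALREADY of bidegree `(0,0)`) gives Castelnuovo–Severi for every `D(f)` —
but only through RH: `Criterion ⟹ RH` is the zero-detection theorem `riemannHypothesis_iff_poleFree`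
(it discharges `eq15` in `MotivicDoorCC2019Criterion.lean`, `eq15_holds`), then `RH ⟹ WeilPositivity`.
Essay Lemma 2.1's hypothesis (2) ("`s(x,x) > 0 ⟹ s(x,ξ₀) ≠ 0 ∨ s(x,ξ₁) ≠ 0`" for ALL classes `x`,
rulings included) is Weil positivity itself (`two_mul_ccPairing_sub_two_mul_masses_eq`), so the
one-line lemma is not what separates (15) from Castelnuovo–Severi here. -/
theorem forall_ccPairing_le_masses_of_criterion (h15 : eq15) (hC : Criterion) :
    ∀ u : ℝ → ℝ, IsWeilTest (fun t ↦ (u t : ℂ)) →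
      2 * ccPairing (toMul u) (toMul u) ≤ 2 * (massDstar (toMul u) * massDu (toMul u)) :=
  forall_ccPairing_le_masses_iff_riemannHypothesis.2 (h15.2 hC)

end Summit.RiemannHypothesis.RiemannHypothesis.Theorems.MotivicDoor.ConnesConsani
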